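import Summits.CriticalPhenomena.PercolationContinuityZ3.Theorems.PercLowPointHalfSpaceBoundaryTwoArmDecayStubStep
import Summits.CriticalPhenomena.PercolationContinuityZ3.Theorems.PercLowPointHalfSpaceBoundaryTwoArmDecayStubCensus
import Summits.CriticalPhenomena.PercolationContinuityZ3.Theorems.PercLowPointHalfSpaceBoundaryTwoArmDecayStubTallDensity
import Summits.CriticalPhenomena.PercolationContinuityZ3.Theorems.PercLowPointHalfSpaceBoundaryTwoArmDecayStaircaseReduction

/-!
# Stub `stub_kTailOfDecoupling` of crux `BoundaryTwoArmDecay` (stmt-CriticalPhenomena-0911): the BRIDGE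
# `SubpolynomialBlocking → Q (floor decoupling) → Q_conf (confinement) → KTail`

Proves EXACTLY the registered stub `stub_kTailOfDecoupling` of the (reshaped) crux skeleton
`Cruxes/BoundaryTwoArmDecay/Lines/staircase_bootstrap_floor_decoupling.lean` (line
`staircase-bootstrap-floor-decoupling`, crux `PercLowPointHalfSpace.BoundaryTwoArmDecay`); lands with
`--supports stmt-CriticalPhenomena-0911`.  It is the monotonicity certificate of the reshape
`{Q, Q_conf, step} ↦ {KTail, directStep}`: the ONE new conjecture KTail of the reshaped line is implied by the
old pair (Q, Q_conf) together with the tagged sibling crux `SubpolynomialBlocking` (stmt-4446, by name).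

Notation (`μ = bondPercolation (zdGraph 3) (criticalProbI 3)`, all objects from `…StubStepSymm/…StubStepCount`):
`A_n = kissV n 0 1` (both `ℍ`-clusters of the adjacent floor roots `0, e` meet level `n` and are distinct),
`K_n = (partnerKiss n ω).ncard` (partner-kiss floor edges of `U = C_ℍ(0)`), `conf n` (`U ⊆` open sup-ball `B_{3n}`).

* Q      : `∃ C d₀, P(A_n ∩ kissV m x j) ≤ C P(A_n) P(kissV m x j)` for floor roots `x` with `3m ≤ |x|_floor`,
           `d₀ ≤ m ≤ n`, `j ≠ 0`;
* Q_conf : `∀ s > 0`, eventually `n^{-s} P(A_n) ≤ P(A_n ∩ conf n)`;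
* KTail  : `∀ s > 0`, eventually `n^{-s} P(A_n) ≤ P(A_n ∩ {K_n ≤ ⌈n^s⌉})`.

## Proof

(1) A-PRIORI EXPONENT 2.  One round of the old staircase is the landed `StubStep.aprioriV_step` (fed by the landed
truncated census `stub_census` and the landed tall density `stub_tallDensity hB`, and by Q, Q_conf); three rounds
from the trivial seed (`StaircaseReduction.three_rounds` with `σ' = 1/3`) give `P(A_m) ≤ C_a m^{-2}` for `m ≥ 1`.

(2) ONE VALUE OF `n` (`StubKTailOfDecoupling.pointwise`, the computation of `StubStep.one_round` run the other
way).  With `k = ⌈n^s⌉`, `y = n^{s/4}`, `z = n^{s/2} = y²`, `n^s = z²`: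
`StubStep.inter_conf_subset_union` and `measureReal_union_le` give `P(A_n ∩ conf n) ≤ P₁ + P₂`,
`P₁ = P(A_n ∩ {K_n ≤ k})`, `P₂ = P(A_n ∩ {k < 2N})`; Markov (`StubStep.markov_bigN`), the pricing of the far
roots by Q and the a-priori bound (`StubStep.sum_price_le`) and `StubStep.S_le` (with `a = 2`, so
`max 0 (2 - a) = 0`, and `δ = s/4`) give `(k+1) P₂ ≤ P(A_n) S(n)`, `S(n) ≤ C_S y`; with `n^s ≤ k + 1` this is
`z² P₂ ≤ C_S y P(A_n)`.  Confinement at loss `s/2` gives `P(A_n) ≤ z (P₁ + P₂)`, whence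
`z² P₁ ≥ (z - C_S y) P(A_n) = y (y - C_S) P(A_n) ≥ P(A_n)` as soon as `y ≥ C_S + 1`.

(3) EVENTUALLY.  `y = n^{s/4} → ∞` (`tendsto_rpow_atTop`), and Q_conf at loss `s/2` holds eventually.
-/

noncomputable section

namespace Summit.CriticalPhenomena.PercolationContinuityZ3.Theorems.BoundaryTwoArmDecay

open MeasureTheory Filter
open Literature.Probability.Percolation Literature.Probability.LatticeModels

namespace StubKTailOfDecoupling

open Negative (μ)
open StubStep

/-- **One value of `n`.** Under Q (constant `C_Q`, scale `d₀`), the a-priori bound with exponent `2`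
(constant `C_a`), confinement AT `n` with loss `s/2` and `n^{s/4} ≥ C_S + 1`
(`C_S = (4 #F_small + 1156 C_Q⁺ C_a⁺)(1 + 8/s)`): `n^{-s} P(A_n) ≤ P(A_n ∩ {K_n ≤ ⌈n^s⌉})`. -/
theorem pointwise {C_Q C_a s : ℝ} {d₀ n : ℕ} (hn : 1 ≤ n) (hs : 0 < s)
    (hQ : ∀ (j : Fin 3) (n m : ℕ) (x : Site 3), j ≠ 0 → x 0 = 0 → d₀ ≤ m → m ≤ n →
      3 * m ≤ floorSup x →
        μ.real (kissV n 0 1 ∩ kissV m x j) ≤ C_Q * μ.real (kissV n 0 1) * μ.real (kissV m x j))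
    (hAp : ∀ m : ℕ, 1 ≤ m → μ.real (kissV m 0 1) ≤ C_a * (m : ℝ) ^ (-(2 : ℝ)))
    (hconf : (n : ℝ) ^ (-(s / 2)) * μ.real (kissV n 0 1) ≤ μ.real (kissV n 0 1 ∩ conf n))
    (hbig : (4 * ((floorBox (6 * d₀ + 2)).card : ℝ) + 1156 * (max C_Q 0 * max C_a 0)) * (1 + 2 / (s / 4)) + 1 ≤
      (n : ℝ) ^ (s / 4)) :
    (n : ℝ) ^ (-s) * μ.real (kissV n 0 1) ≤
      μ.real (kissV n 0 1 ∩ {ω | (partnerKiss n ω).ncard ≤ ⌈(n : ℝ) ^ s⌉₊}) := by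
  have hn1 : (1 : ℝ) ≤ n := by exact_mod_cast hn
  have hnpos : (0 : ℝ) < n := by positivity
  have hs4 : 0 < s / 4 := by positivity
  -- name the players
  obtain ⟨k, hk⟩ : ∃ k : ℕ, k = ⌈(n : ℝ) ^ s⌉₊ := ⟨_, rfl⟩
  rw [← hk]
  obtain ⟨P, hP⟩ : ∃ P : ℝ, P = μ.real (kissV n 0 1) := ⟨_, rfl⟩
  obtain ⟨P₁, hP₁⟩ : ∃ P₁ : ℝ, P₁ = μ.real (kissV n 0 1 ∩ {ω | (partnerKiss n ω).ncard ≤ k}) := ⟨_, rfl⟩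
  obtain ⟨P₂, hP₂⟩ : ∃ P₂ : ℝ, P₂ = μ.real (kissV n 0 1 ∩ {ω | k < 2 * bigN d₀ n ω}) := ⟨_, rfl⟩
  obtain ⟨y, hy⟩ : ∃ y : ℝ, y = (n : ℝ) ^ (s / 4) := ⟨_, rfl⟩
  obtain ⟨z, hz⟩ : ∃ z : ℝ, z = (n : ℝ) ^ (s / 2) := ⟨_, rfl⟩
  obtain ⟨x, hx⟩ : ∃ x : ℝ, x = (n : ℝ) ^ s := ⟨_, rfl⟩
  obtain ⟨W, hW⟩ : ∃ W : ℝ, W = weightSum 2 d₀ n := ⟨_, rfl⟩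
  obtain ⟨S, hS⟩ : ∃ S : ℝ,
      S = 4 * ((floorBox (6 * d₀ + 2)).card : ℝ) + 2 * (max C_Q 0 * max C_a 0) * W := ⟨_, rfl⟩
  obtain ⟨C_S, hCS⟩ : ∃ C_S : ℝ,
      C_S = (4 * ((floorBox (6 * d₀ + 2)).card : ℝ) + 1156 * (max C_Q 0 * max C_a 0)) * (1 + 2 / (s / 4)) :=
    ⟨_, rfl⟩
  -- signs and sizes
  have hC0 : 0 ≤ max C_Q 0 * max C_a 0 := mul_nonneg (le_max_right _ _) (le_max_right _ _)
  have hCS0 : 0 ≤ C_S := by rw [hCS]; positivity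
  have hy1 : C_S + 1 ≤ y := by rw [hCS, hy]; exact hbig
  have hy0 : 0 < y := by linarith
  have hzy : z = y * y := by rw [hz, hy, ← Real.rpow_add hnpos]; ring_nf
  have hxz : x = z * z := by rw [hx, hz, ← Real.rpow_add hnpos]; ring_nf
  have hz0 : 0 < z := by rw [hzy]; positivity
  have hx0 : 0 < x := by rw [hxz]; positivity
  have hP0 : 0 ≤ P := by rw [hP]; exact measureReal_nonneg
  have hP20 : 0 ≤ P₂ := by rw [hP₂]; exact measureReal_nonneg
  have hkS : x ≤ (k : ℝ) + 1 := by
    have := Nat.le_ceil ((n : ℝ) ^ s)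
    rw [← hk, ← hx] at this
    linarith
  -- (S3) the split and Markov, (S4) pricing
  have hsplit : μ.real (kissV n 0 1 ∩ conf n) ≤ P₁ + P₂ := by
    rw [hP₁, hP₂]
    exact (measureReal_mono (inter_conf_subset_union d₀ n k)).trans (measureReal_union_le _ _)
  have hmarkov : ((k : ℝ) + 1) * P₂ ≤ P * S := by
    have hM := markov_bigN d₀ n k
    have hprice := sum_price_le hn hQ hAp
    rw [← hP, ← hP₂] at hM
    rw [← hP, ← hW] at hprice
    rw [hS]
    calc _ ≤ _ := hM
      _ ≤ _ := by linarith
  -- `S ≤ C_S y` (`a = 2`: `max 0 (2 - a) = 0`, `δ = s/4`)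
  have hSle : S ≤ C_S * y := by
    have h := S_le (a := 2) hC0 hs4 ((floorBox (6 * d₀ + 2)).card) d₀ hn
    rw [← hW, ← hS, ← hCS] at h
    have hexp : max 0 (2 - (2 : ℝ)) + s / 4 = s / 4 := by norm_num
    rw [hexp, ← hy] at h
    exact h
  -- (A) `x P₂ ≤ C_S y P`
  have hA : x * P₂ ≤ C_S * y * P :=
    calc x * P₂ ≤ ((k : ℝ) + 1) * P₂ := mul_le_mul_of_nonneg_right hkS hP20
      _ ≤ P * S := hmarkov
      _ ≤ P * (C_S * y) := mul_le_mul_of_nonneg_left hSle hP0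
      _ = C_S * y * P := by ring
  -- (B) confinement at loss `s/2`: `P ≤ z (P₁ + P₂)`
  have hB : P ≤ z * (P₁ + P₂) := by
    have h := hconf.trans hsplit
    rw [Real.rpow_neg hnpos.le, ← hz, ← hP] at h
    exact (inv_mul_le_iff₀ hz0).1 h
  -- (C) `P ≤ (z - C_S y) P` since `z - C_S y = y (y - C_S) ≥ 1`
  have hC : P ≤ (z - C_S * y) * P := by
    refine le_mul_of_one_le_left hP0 ?_
    rw [hzy]
    nlinarith [mul_le_mul_of_nonneg_right hy1 hy0.le]
  -- assembly: `P ≤ z P - C_S y P ≤ z² (P₁ + P₂) - z² P₂ = x P₁`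
  have hfin : P ≤ x * P₁ := by
    have h1 : z * P ≤ z * (z * (P₁ + P₂)) := mul_le_mul_of_nonneg_left hB hz0.le
    rw [hxz] at hA ⊢
    nlinarith [h1, hA, hC]
  rw [Real.rpow_neg hnpos.le, ← hx, ← hP, ← hP₁, inv_mul_le_iff₀ hx0]
  exact hfin

/-- **The bridge** (the content of `stub_kTailOfDecoupling`, hypotheses in the local vocabulary): the truncated
census, the tall-density bound, Q and Q_conf give KTail. -/
theorem kTail_of_decoupling
    (hCensus : ∃ C : ℝ, ∀ n k : ℕ, 1 ≤ n → 1 ≤ k →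
      μ.real (kissV n 0 1 ∩ {ω | (partnerKiss n ω).ncard ≤ k}) ≤ C * (k : ℝ) * (exactDens n).toReal)
    (hTall : ∀ s : ℝ, 0 < s → ∃ C : ℝ, ∀ n : ℕ, 1 ≤ n → tallDens n ≤ ENNReal.ofReal (C * (n : ℝ) ^ (s - 2)))
    (hQ : ∃ C : ℝ, ∃ d₀ : ℕ, ∀ (j : Fin 3) (n m : ℕ) (x : Site 3), j ≠ 0 → x 0 = 0 → d₀ ≤ m → m ≤ n →
      3 * m ≤ floorSup x →
        μ.real (kissV n 0 1 ∩ kissV m x j) ≤ C * μ.real (kissV n 0 1) * μ.real (kissV m x j))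
    (hConf : ∀ s : ℝ, 0 < s → ∀ᶠ n : ℕ in Filter.atTop,
      (n : ℝ) ^ (-s) * μ.real (kissV n 0 1) ≤ μ.real (kissV n 0 1 ∩ conf n))
    {s : ℝ} (hs : 0 < s) :
    ∀ᶠ n : ℕ in Filter.atTop, (n : ℝ) ^ (-s) * μ.real (kissV n 0 1) ≤
      μ.real (kissV n 0 1 ∩ {ω | (partnerKiss n ω).ncard ≤ ⌈(n : ℝ) ^ s⌉₊}) := by
  -- (1) a-priori exponent 2: three rounds of the landed staircase from the trivial seed, `σ' = 1/3`
  have hS : ∀ a : ℝ, 0 ≤ a →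
      (∃ C : ℝ, ∀ n : ℕ, 1 ≤ n → μ.real (kissV n 0 1) ≤ C * (n : ℝ) ^ (-a)) →
      ∀ σ : ℝ, 0 < σ →
        ∃ C : ℝ, ∀ n : ℕ, 1 ≤ n → μ.real (kissV n 0 1) ≤ C * (n : ℝ) ^ (-(3 - σ - max 0 (2 - a))) :=
    fun a ha hAp σ hσ => aprioriV_step hCensus hTall hQ hConf ha hAp hσ
  have h3 := StaircaseReduction.three_rounds hS (σ := 1 / 3) (by norm_num) (by norm_num)
  have h2 : ∃ C : ℝ, ∀ n : ℕ, 1 ≤ n → μ.real (kissV n 0 1) ≤ C * (n : ℝ) ^ (-(2 : ℝ)) :=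
    StaircaseReduction.aprioriV_mono (by norm_num) h3
  obtain ⟨C_a, hCa⟩ := h2
  obtain ⟨C_Q, d₀, hQ'⟩ := hQ
  -- (3) eventually: confinement at loss `s/2` and `n^{s/4} ≥ C_S + 1`
  have hs2 : 0 < s / 2 := by positivity
  have hs4 : 0 < s / 4 := by positivity
  obtain ⟨N₀, hN₀⟩ := Filter.eventually_atTop.1 (hConf (s / 2) hs2)
  have hbig : ∀ᶠ n : ℕ in Filter.atTop,
      (4 * ((floorBox (6 * d₀ + 2)).card : ℝ) + 1156 * (max C_Q 0 * max C_a 0)) * (1 + 2 / (s / 4)) + 1 ≤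
        (n : ℝ) ^ (s / 4) :=
    ((tendsto_rpow_atTop hs4).comp tendsto_natCast_atTop_atTop).eventually_ge_atTop _
  filter_upwards [hbig, Filter.eventually_ge_atTop (max N₀ 1)] with n hbn hn
  -- (2) one value of `n`
  exact pointwise (le_of_max_le_right hn) hs hQ' hCa (hN₀ n (le_of_max_le_left hn)) hbn

end StubKTailOfDecoupling

open StubKTailOfDecoupling in
/-- **Registered stub `stub_kTailOfDecoupling`** of the skeleton
`Cruxes/BoundaryTwoArmDecay/Lines/staircase_bootstrap_floor_decoupling.lean` (line `staircase-bootstrap-floor-decoupling`,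
reshaped by lead c1) — the BRIDGE `SubpolynomialBlocking → Q (floor decoupling) → Q_conf (confinement) → KTail`,
i.e. the monotonicity certificate of the reshape (old debt ⇒ new debt): three rounds of the landed staircase
(`StubStep.aprioriV_step`, fed by the landed `stub_census` and `stub_tallDensity`) give the a-priori exponent `2`;
then, at a fixed large `n` with `k = ⌈n^s⌉`, the split on the confined event, Markov for the counting majorant, the
Q-pricing of the far roots (`S(n) ≲ n^{s/4}`) and confinement at loss `s/2` give `n^{-s} P(A_n) ≤ P(A_n ∩ {K_n ≤ k})`.
Proof: `StubKTailOfDecoupling.kTail_of_decoupling`. -/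
theorem stub_kTailOfDecoupling :
    Summit.CriticalPhenomena.PercolationContinuityZ3.Theses.PercNonProliferation.SubpolynomialBlocking →
    (∃ C : ℝ, ∃ d₀ : ℕ, ∀ (j : Fin 3) (n m : ℕ) (x : Site 3), j ≠ 0 → x 0 = 0 → d₀ ≤ m → m ≤ n →
      3 * m ≤ max (x 1).natAbs (x 2).natAbs →
        (bondPercolation (zdGraph 3) (criticalProbI 3)).real
            ({ω | (∃ y : Site 3, (n : ℤ) ≤ y 0 ∧ ω ∈ openConnIn (halfSpace 3) 0 y) ∧
                (∃ y : Site 3, (n : ℤ) ≤ y 0 ∧ ω ∈ openConnIn (halfSpace 3) ((0 : Site 3) + Pi.single 1 1) y) ∧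
                ω ∉ openConnIn (halfSpace 3) 0 ((0 : Site 3) + Pi.single 1 1)} ∩
              {ω | (∃ y : Site 3, (m : ℤ) ≤ y 0 ∧ ω ∈ openConnIn (halfSpace 3) x y) ∧
                (∃ y : Site 3, (m : ℤ) ≤ y 0 ∧ ω ∈ openConnIn (halfSpace 3) (x + Pi.single j 1) y) ∧
                ω ∉ openConnIn (halfSpace 3) x (x + Pi.single j 1)}) ≤
          C * (bondPercolation (zdGraph 3) (criticalProbI 3)).real
              {ω | (∃ y : Site 3, (n : ℤ) ≤ y 0 ∧ ω ∈ openConnIn (halfSpace 3) 0 y) ∧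
                (∃ y : Site 3, (n : ℤ) ≤ y 0 ∧ ω ∈ openConnIn (halfSpace 3) ((0 : Site 3) + Pi.single 1 1) y) ∧
                ω ∉ openConnIn (halfSpace 3) 0 ((0 : Site 3) + Pi.single 1 1)} *
            (bondPercolation (zdGraph 3) (criticalProbI 3)).real
              {ω | (∃ y : Site 3, (m : ℤ) ≤ y 0 ∧ ω ∈ openConnIn (halfSpace 3) x y) ∧
                (∃ y : Site 3, (m : ℤ) ≤ y 0 ∧ ω ∈ openConnIn (halfSpace 3) (x + Pi.single j 1) y) ∧
                ω ∉ openConnIn (halfSpace 3) x (x + Pi.single j 1)}) →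
    (∀ s : ℝ, 0 < s → ∀ᶠ n : ℕ in Filter.atTop,
      (n : ℝ) ^ (-s) *
          (bondPercolation (zdGraph 3) (criticalProbI 3)).real
            {ω | (∃ y : Site 3, (n : ℤ) ≤ y 0 ∧ ω ∈ openConnIn (halfSpace 3) 0 y) ∧
              (∃ y : Site 3, (n : ℤ) ≤ y 0 ∧ ω ∈ openConnIn (halfSpace 3) ((0 : Site 3) + Pi.single 1 1) y) ∧
              ω ∉ openConnIn (halfSpace 3) 0 ((0 : Site 3) + Pi.single 1 1)} ≤
        (bondPercolation (zdGraph 3) (criticalProbI 3)).real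
          ({ω | (∃ y : Site 3, (n : ℤ) ≤ y 0 ∧ ω ∈ openConnIn (halfSpace 3) 0 y) ∧
              (∃ y : Site 3, (n : ℤ) ≤ y 0 ∧ ω ∈ openConnIn (halfSpace 3) ((0 : Site 3) + Pi.single 1 1) y) ∧
              ω ∉ openConnIn (halfSpace 3) 0 ((0 : Site 3) + Pi.single 1 1)} ∩
            {ω | ∀ y : Site 3, ω ∈ openConnIn (halfSpace 3) 0 y → ∀ i : Fin 3, |y i| < ((3 * n : ℕ) : ℤ)})) →
    ∀ s : ℝ, 0 < s → ∀ᶠ n : ℕ in Filter.atTop,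
      (n : ℝ) ^ (-s) *
          (bondPercolation (zdGraph 3) (criticalProbI 3)).real
            {ω | (∃ y : Site 3, (n : ℤ) ≤ y 0 ∧ ω ∈ openConnIn (halfSpace 3) 0 y) ∧
              (∃ y : Site 3, (n : ℤ) ≤ y 0 ∧ ω ∈ openConnIn (halfSpace 3) ((0 : Site 3) + Pi.single 1 1) y) ∧
              ω ∉ openConnIn (halfSpace 3) 0 ((0 : Site 3) + Pi.single 1 1)} ≤
        (bondPercolation (zdGraph 3) (criticalProbI 3)).real
          ({ω | (∃ y : Site 3, (n : ℤ) ≤ y 0 ∧ ω ∈ openConnIn (halfSpace 3) 0 y) ∧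
              (∃ y : Site 3, (n : ℤ) ≤ y 0 ∧ ω ∈ openConnIn (halfSpace 3) ((0 : Site 3) + Pi.single 1 1) y) ∧
              ω ∉ openConnIn (halfSpace 3) 0 ((0 : Site 3) + Pi.single 1 1)} ∩
            {ω | {q : Site 3 × Site 3 | q.1 0 = 0 ∧ q.2 0 = 0 ∧ (zdGraph 3).Adj q.1 q.2 ∧
                ω ∈ openConnIn (halfSpace 3) 0 q.1 ∧ ω ∉ openConnIn (halfSpace 3) 0 q.2 ∧
                ∃ y : Site 3, (n : ℤ) ≤ y 0 ∧ ω ∈ openConnIn (halfSpace 3) q.2 y}.ncard ≤ ⌈(n : ℝ) ^ s⌉₊}) :=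
  fun hB hQ hConf _s hs => kTail_of_decoupling stub_census (stub_tallDensity hB) hQ hConf hs

end Summit.CriticalPhenomena.PercolationContinuityZ3.Theorems.BoundaryTwoArmDecay

end
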